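import Summits.BirchSwinnertonDyer.BirchSwinnertonDyer.Theorems.AdditiveBranchIMCGordTwoRankOneHeegnerKolyvaginSmallImageCertificate
import Summits.BirchSwinnertonDyer.BirchSwinnertonDyer.Theorems.AdditiveBranchIMCGordTwoRankOneHeegnerKolyvaginUpper
import HarnessLib

/-!
# Route `AdditiveBranchIMC` (rung K1), crux `GordTwoRankOne` (item 19358): the Heegner–Kolyvagin road,
# Part 20b — `BSD(E,p)` (BOTH halves) on the SMALL-IMAGE rows at `p ≥ 5`: the prime-level Kolyvagin certificate
# (Matar–Nekovář's EXACT order of `Ш(E/K)[p^∞]`) gives the UPPER half too — Kolyvagin 1990 Thm. A (surjective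
# image) is not needed (cell `bsd-addord`, second prover lane `bsd-addord-k1-c3x`, gen 4; `--supports` only)

HONEST FRAMING. THEOREMS ONLY: no definition, no new named fact, no `sorry`; nothing is booked; crux 19358 stays OPEN;
BSD is not proved by any of this. Displayed inputs (`hCertW`/`hPCert`, `hA`/`hAsm`, `hTwLW`/`hTwL`) are never asserted.

WHY. On a small-image row (`E[p]` irreducible, `ρ̄_{E,p^n}` not onto) Part 6's UPPER half is unavailable: Kolyvagin's
1990 bound `ord_p #Ш(E/K) ≤ 2·ord_p[E(K):ℤy_K]` is cited for `ρ̄_{E,p}` onto (`Kolyvagin1990_padicValNat_card_sha_le`).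
But the prime-level certificate of Part 20 gives, through Matar–Nekovář 2019, the EXACT order
`#Ш(E/K)[p^∞] = p^{2M₀}` with `M₀ = ord_p[E(K):ℤy_K]` — in particular Kolyvagin's inequality at that frame, with NO
image hypothesis beyond irreducibility. Feeding it to x11b's class-free `missingUpperBoundAt_of_shaIndexBound` (the
door behind Part 6) with the rank-ZERO LOWER half of the twist (crux 19357's conclusion at `(Wd, p)`) gives UPPER(E),
and Part 20 §36 gives LOWER(E). HENCE: §38 `bsdp_rankOne_additive_potGood_irr_five_of_primeCertificate_of_twistLower`
(one pair, `p ≥ 5`, `p ∤ ∏c_ℓ(E)`) and its class-level form on the small-image rows of cell (G-ord, `e = 2`):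
`BSDp W p ⟸ PUB (hPub, hKatoI, hMN, cite-only hMz hAU hC2) + [prime-level certificate at the odd Manin-good frames] +
[Conjecture A at the twists] + [19357 at the twists]` — the O8-row twin of Part 18b's ♯-row theorem
(`21398 ∧ 19357(twists) ∧ PUB ⟹ BSDp`). `p ≥ 5` enters only through the Tamagawa transport
`ord_p ∏c(E^{d_K}) = ord_p ∏c(E)` (x11b, odd `d_K`, `p ∤ d_K`).

References: [MatarNekovar2019] Thm. 0.7, §0.11; [McCallumLMS1991] §5 Lemma 5.1; [GrossZagier1986] V.§2;
[JetchevSkinnerWan2017] §7.4.1–7.4.3; [Kato2004Asterisque] Thm. 14.5 (3), Prop. 14.16 (2); [CoatesSujatha2005] (A);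
[Darmon2004] Thm. 3.6; [EdixhovenManin1991] §1; [Mazur1978] Cor. 4.1; [Miller2011LMS] Def. 1.1.
-/

set_option autoImplicit false
set_option linter.dupNamespace false
noncomputable section
open scoped Classical NumberField
open WeierstrassCurve NumberField IsDedekindDomain Literature.NumberTheory.EllipticCurves
  Literature.NumberTheory.EllipticCurves.ModularForms Literature.NumberTheory.EllipticCurves.Rank1Residual
  Literature.NumberTheory.EllipticCurves.Rank1Residual.Typed Literature.NumberTheory.Automorphic
  Summit.BirchSwinnertonDyer.Rank1Residual Summit.BirchSwinnertonDyer.Rank1Residual.Additive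
  Summit.BirchSwinnertonDyer.Rank1Residual.X11b Summit.BirchSwinnertonDyer.Rank1Residual.GaloisImage
  Summit.BirchSwinnertonDyer.BirchSwinnertonDyer.Theses.AdditiveKolyvaginRoad
  Summit.BirchSwinnertonDyer.BirchSwinnertonDyer.Theorems.AdditiveKolyvaginKernel

namespace Summit.BirchSwinnertonDyer.BirchSwinnertonDyer.Theorems.AdditiveBranchIMCGordTwoRankOne.HeegnerKolyvagin

/-! ### §38 `BSD(E,p)` on a small-image row at `p ≥ 5`: prime certificate (both halves) + Conj A + 19357 at the twists -/

/-- **UPPER(E,p) on a small-image row from ONE prime-level certificate + the rank-zero LOWER half of the twist**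
(one pair, `p ≥ 5`). `W/ℚ` globally minimal non-CM, `p ≥ 5` ADDITIVE potentially good, `r_an = 1`, `E[p]` irreducible
(any image), `p ∤ ∏c_ℓ(E)`; PUB `hPub`, `hMN`; a datum with `p ∤ c` (`hD`); DISPLAYED: `hCertW` (prime-level
certificate at the odd Manin-good frames with `d_K < −4`) and `hTwLW` (`Typed.MissingLowerBoundAt Wd p` at every
globally minimal Heegner twist `Wd` of `W` with `L(E^{d_K},1) ≠ 0` — crux 19357's conclusion there). At the kernel's
Hoffstein–Luo frame Matar–Nekovář gives `ord_p #Ш(E/K) = 2·ord_p[E(K):ℤP]` (§35's ingredients), which is the `hU` of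
x11b's `missingUpperBoundAt_of_shaIndexBound`; Tamagawa transport `ord_p ∏c(Wd) = ord_p ∏c(E)` (x11b, `p ≥ 5`).
[cite: MatarNekovar2019, Thm. 0.7 and §0.11 (pp. 456–457)] [cite: McCallumLMS1991, §5 Lemma 5.1 (p. 303)]
[cite: JetchevSkinnerWan2017, §7.4.2 (eq:shaupper), p. 31] [cite: Darmon2004, Thm. 3.6] [cite: Miller2011LMS, Def. 1.1] -/
theorem missingUpperBoundAt_rankOne_additive_irr_five_of_primeCertificate_of_twistLower
    (hPub : PublishedInputsAdditiveKoly)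
    (hMN : MatarNekovar2019_card_sha_primary_baseChange_of_derivedPoint_not_divisible_of_irreducible)
    (W : WeierstrassCurve ℚ) [W.IsElliptic] [W.IsGloballyMinimal] [NeZero (W.conductorNorm ℤ)]
    (p : ℕ) [Fact p.Prime] (hCM : ¬ W.HasCM) (hp5 : 5 ≤ p) (hadd : Addv W p)
    (hr : W.analyticRank = 1) (hirr : W.HasIrreducibleModPGaloisRep p) (htam0 : ¬ p ∣ W.tamagawaProduct)
    (hD : ∃ Dt : ModularParametrizationData W (W.conductorNorm ℤ), ¬ (p : ℤ) ∣ Dt.c)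
    (hCertW : ∀ (K : Type) [Field K] [NumberField K]
      (Dt : ModularParametrizationData W (W.conductorNorm ℤ)) (β : ℤ) (ι : K →+* ℂ),
      IsImaginaryQuadratic K → Odd (NumberField.discr K) → NumberField.discr K < -4 →
      SatisfiesHeegnerHypothesis (W.conductorNorm ℤ) K →
      (W.quadraticTwist (NumberField.discr K : ℚ)).entireLFunction 1 ≠ 0 →
      (4 * (W.conductorNorm ℤ : ℤ)) ∣ β ^ 2 - NumberField.discr K → ¬ (p : ℤ) ∣ Dt.c →
      ∃ (ℓ : ℕ) (d : KolyvaginHeegnerData Dt β ι ℓ), Zhang2014.IsKolyvaginPrime (W.conductorNorm ℤ) W K p ℓ ∧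
        ¬ ∃ Q : (W.baseChange (ringClassField K ι ℓ)).toAffine.Point, (p : ℤ) • Q = d.derivedPoint)
    (hTwLW : ∀ (K : Type) [Field K] [NumberField K]
      (Wd : WeierstrassCurve ℚ) [Wd.IsElliptic] [Wd.IsGloballyMinimal] (Cd : VariableChange ℚ),
      IsImaginaryQuadratic K → SatisfiesHeegnerHypothesis (W.conductorNorm ℤ) K →
      (W.quadraticTwist (NumberField.discr K : ℚ)).entireLFunction 1 ≠ 0 →
      Cd • W.quadraticTwist (NumberField.discr K : ℚ) = Wd → Typed.MissingLowerBoundAt Wd p) :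
    Typed.MissingUpperBoundAt W p := by
  obtain ⟨hGZ, hKo, -, hGZK, hmod, hnf, hHL, hrec, -, h36⟩ := hPub
  have hp : p.Prime := Fact.out
  have hp2 : p ≠ 2 := by omega
  -- the odd Hoffstein–Luo frame with `d_K < -4` on the datum with `p ∤ c`; Darmon's datum; Kolyvagin; no `p`-torsion
  obtain ⟨K, _, _, Dt, H, ι, P, Wd, _, _, Cd, hK, hodd, hlt, hpd, hHN, hP, hc, hμ, hLt, hWd⟩ :=
    exists_oddHeegnerFrame_lt_of_exists_not_dvd hnf hHL W p hr hp2 hD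
  have h3 : NumberField.discr K ≠ -3 := by omega
  have h4 : NumberField.discr K ≠ -4 := by omega
  obtain ⟨d₁⟩ := kolyvaginRoadThree_hKD_of_darmon36 h36 W K Dt H.β ι hK hHN H.dvd_sq_sub
  have hPd : d₁.toGeomPoints d₁.derivedPoint = toGeomPoints (W.baseChange K) P :=
    KolyvaginBottom.toGeomPoints_derivedPoint_one_eq (hrec _ W K) hK hHN hP d₁ rfl
  have hPinf : ¬ IsOfFinAddOrder P :=
    not_isOfFinAddOrder_of_heegner_of_analyticRank_eq_one W (W.conductorNorm ℤ) K Dt H ι P (hGZ _ W K)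
      hmod hr hK hHN hLt hP
  obtain ⟨hrank, hSha⟩ := hKo (W.conductorNorm ℤ) W K hK hHN ⟨Dt, H, ι, hP⟩ hPinf
  haveI : Finite (W.baseChange K).sha := hSha
  have hbot := torsionBy_eq_bot_of_isImaginaryQuadratic_of_hasIrreducibleModPGaloisRep W K hK hp hirr
  have hiv : ∀ x : (W.baseChange K).toAffine.Point, p • x = 0 → x = 0 := fun x hx ↦ by
    have hmem : x ∈ AddSubgroup.torsionBy (W.baseChange K).toAffine.Point ((p : ℕ) : ℤ) := by
      rw [mem_torsionBy_iff, natCast_zsmul]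
      exact hx
    rw [hbot] at hmem
    exact hmem
  haveI : Module.Finite ℤ (W.baseChange K).toAffine.Point := (W.baseChange K).module_finite_point_holds
  obtain ⟨M₀, x₀, hx₀, hmax⟩ := exists_pow_smul_eq_and_forall_ne hPinf (p := p) hp.two_le
  have hdiv : ∃ Q : (W.baseChange K).toAffine.Point, ((p ^ M₀ : ℕ) : ℤ) • Q = P :=
    ⟨x₀, by rw [natCast_zsmul]; exact hx₀⟩
  have hndiv : ¬ ∃ Q : (W.baseChange K).toAffine.Point, ((p ^ (M₀ + 1) : ℕ) : ℤ) • Q = P := by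
    rintro ⟨Q, hQ⟩
    exact hmax Q (by rw [← natCast_zsmul]; exact hQ)
  -- the prime-level certificate; Matar–Nekovář: `#Ш(E/K)[p^∞] = p^{2M₀}`, and `ord_p[E(K):ℤP] = M₀`
  obtain ⟨ℓ, d, hℓ, hcert⟩ := hCertW K Dt H.β ι hK hodd hlt hHN hLt H.dvd_sq_sub hc
  have hcard : Nat.card (AddCommGroup.primaryComponent (W.baseChange K).sha p) = p ^ (2 * M₀) :=
    hMN W hCM K hK h3 h4 hHN p hp2 hirr Dt H.β ι d₁ P hPd hPinf M₀ hdiv hndiv ℓ d hℓ hcert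
  have hsha : padicValNat p (W.baseChange K).shaOrder =
      padicValNat p (Nat.card (AddCommGroup.primaryComponent (W.baseChange K).sha p)) :=
    Three.Koly.padicValNat_shaOrder_eq (W.baseChange K) p
  haveI : Finite (AddCommGroup.torsion (W.baseChange K).toAffine.Point) :=
    WeierstrassCurve.finite_torsion_point (W := W.baseChange K)
  obtain ⟨c, Q, hcQ, hcker⟩ := RankOne.exists_coord_of_mordellWeilRank_eq_one (W.baseChange K) hrank
  have hidx : padicValNat p (AddSubgroup.zmultiples P).index = M₀ :=
    Three.Koly.padicValNat_index_zmultiples_eq_of_divisibility c Q hcQ hcker hiv P hdiv hndiv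
  have hU : Finite (W.baseChange K).sha → ¬ IsOfFinAddOrder P →
      padicValNat p (Nat.card (W.baseChange K).sha) ≤ 2 * padicValNat p (AddSubgroup.zmultiples P).index := by
    intro _ _
    have h1 : padicValNat p (W.baseChange K).shaOrder = 2 * M₀ := by rw [hsha, hcard, padicValNat.prime_pow]
    have h2 : padicValNat p (Nat.card (W.baseChange K).sha) = padicValNat p (W.baseChange K).shaOrder := rfl
    rw [h2, h1, hidx]
  -- the twist: minimal model, Tamagawa transport at `p ≥ 5`, and its rank-zero LOWER half (19357 there)
  have hD0 : (NumberField.discr K : ℚ) ≠ 0 := by exact_mod_cast NumberField.discr_ne_zero K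
  haveI hEt : (W.quadraticTwist (NumberField.discr K : ℚ)).IsElliptic := W.isElliptic_quadraticTwist hD0
  have htam : padicValNat p Wd.tamagawaProduct = padicValNat p W.tamagawaProduct :=
    padicValNat_tamagawaProduct_twist_of_heegner W p hp5 K hK hHN Cd hWd
  have hu : padicValRat p (Cd.u : ℚ) = 0 := padicValRat_u_eq_zero_of_twist_minimal' W p K hK hHN hadd.1 Cd hWd
  have hLt' : (W.quadraticTwist (NumberField.discr K : ℚ)).entireLFunction = Wd.entireLFunction := by
    rw [← hWd, entireLFunction_smul]
  have hLd1 : Wd.entireLFunction 1 ≠ 0 := by rw [← hLt']; exact hLt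
  have htw := twist_ge_half_of_missingLowerBoundAt hGZK hmod Wd p hLd1 (hTwLW K Wd Cd hK hHN hLt hWd)
  exact missingUpperBoundAt_of_shaIndexBound W p (W.conductorNorm ℤ) K Dt H ι P (hGZ _ W K) (hKo _ W K) hGZK hmod
    hK hHN hP hp2 hc hμ hr hLt Wd Cd hWd hu htam htam0 htw hU

/-- **`BSD(E,p)` (BOTH halves) on a small-image row, one pair, `p ≥ 5`, `p ∤ ∏c_ℓ(E)`**: LOWER by Part 20 §36 (prime
certificate + Conjecture A at the twists, `hKatoI`), UPPER by the theorem above (prime certificate + 19357 at the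
twists); glued by x11b's `bsdp_of_halves`. No Kolyvagin 1990 Thm. A, no STEP L′, no Manin item, no Λ-adic object.
[cite: MatarNekovar2019, Thm. 0.7 and §0.11] [cite: Kato2004Asterisque, Thm. 14.5 (3) (p. 236) and Prop. 14.16 (2)]
[cite: CoatesSujatha2005, statement (A)] [cite: JetchevSkinnerWan2017, §7.4.1–7.4.3 (pp. 29–31)] [cite: Miller2011LMS, Def. 1.1] -/
theorem bsdp_rankOne_additive_irr_five_of_primeCertificate_of_conjA_of_twistLower
    (hPub : PublishedInputsAdditiveKoly)
    (hKatoI : Kato2004.rankZero_padicValNat_sha_add_padicValNat_tamagawa_le_of_additive_potGood_of_irreducible_of_fineSelmerDual_fg)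
    (hMN : MatarNekovar2019_card_sha_primary_baseChange_of_derivedPoint_not_divisible_of_irreducible)
    (W : WeierstrassCurve ℚ) [W.IsElliptic] [W.IsGloballyMinimal] [NeZero (W.conductorNorm ℤ)]
    (p : ℕ) [Fact p.Prime] (hCM : ¬ W.HasCM) (hp5 : 5 ≤ p) (hadd : Addv W p) (hj : 0 ≤ padicValRat p W.j)
    (hr : W.analyticRank = 1) (hirr : W.HasIrreducibleModPGaloisRep p) (htam0 : ¬ p ∣ W.tamagawaProduct)
    (hD : ∃ Dt : ModularParametrizationData W (W.conductorNorm ℤ), ¬ (p : ℤ) ∣ Dt.c)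
    (hCertW : ∀ (K : Type) [Field K] [NumberField K]
      (Dt : ModularParametrizationData W (W.conductorNorm ℤ)) (β : ℤ) (ι : K →+* ℂ),
      IsImaginaryQuadratic K → Odd (NumberField.discr K) → NumberField.discr K < -4 →
      SatisfiesHeegnerHypothesis (W.conductorNorm ℤ) K →
      (W.quadraticTwist (NumberField.discr K : ℚ)).entireLFunction 1 ≠ 0 →
      (4 * (W.conductorNorm ℤ : ℤ)) ∣ β ^ 2 - NumberField.discr K → ¬ (p : ℤ) ∣ Dt.c →
      ∃ (ℓ : ℕ) (d : KolyvaginHeegnerData Dt β ι ℓ), Zhang2014.IsKolyvaginPrime (W.conductorNorm ℤ) W K p ℓ ∧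
        ¬ ∃ Q : (W.baseChange (ringClassField K ι ℓ)).toAffine.Point, (p : ℤ) • Q = d.derivedPoint)
    (hA : ∀ (K : Type) [Field K] [NumberField K]
      (Wd : WeierstrassCurve ℚ) [Wd.IsElliptic] [Wd.IsGloballyMinimal] (Cd : VariableChange ℚ),
      IsImaginaryQuadratic K → SatisfiesHeegnerHypothesis (W.conductorNorm ℤ) K →
      (W.quadraticTwist (NumberField.discr K : ℚ)).entireLFunction 1 ≠ 0 →
      Cd • W.quadraticTwist (NumberField.discr K : ℚ) = Wd →
      ∀ κ : ZpExtension ℚ p, κ.IsCyclotomic →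
        ∃ (γ : Field.absoluteGaloisGroup ℚ) (D : Wd.FineSelmerDualData κ γ),
          Module.Finite ℤ_[p] (RestrictScalars ℤ_[p] (IwasawaAlgebra p) D.X))
    (hTwLW : ∀ (K : Type) [Field K] [NumberField K]
      (Wd : WeierstrassCurve ℚ) [Wd.IsElliptic] [Wd.IsGloballyMinimal] (Cd : VariableChange ℚ),
      IsImaginaryQuadratic K → SatisfiesHeegnerHypothesis (W.conductorNorm ℤ) K →
      (W.quadraticTwist (NumberField.discr K : ℚ)).entireLFunction 1 ≠ 0 →
      Cd • W.quadraticTwist (NumberField.discr K : ℚ) = Wd → Typed.MissingLowerBoundAt Wd p) :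
    BSDp W p := by
  have hp2 : p ≠ 2 := by omega
  exact bsdp_of_halves hPub.2.2.2.1 W p (le_of_eq hr)
    (missingLowerBoundAt_rankOne_additive_potGood_irr_of_primeCertificate hPub hKatoI hMN W p hCM hp2 hadd hj hr hirr hD
      hCertW hA)
    (missingUpperBoundAt_rankOne_additive_irr_five_of_primeCertificate_of_twistLower hPub hMN W p hCM hp5 hadd hr hirr
      htam0 hD hCertW hTwLW)

/-- **CLASS LEVEL: `BSD(E,p)` on the SMALL-IMAGE rows of cell (G-ord, `e = 2`) ∩ `r_an = 1` at `p ≥ 5`, `p ∤ ∏c_ℓ(E)`**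
(non-CM, `E[p]` irreducible, `ρ̄_{E,p^n}` not onto for some `n`): from PUB (`hPub`, `hKatoI`, `hMN`, cite-only
`hMz hAU hC2` for Part 18a's datum) and the DISPLAYED inputs `hPCert` (prime-level certificates at the odd Manin-good
frames), `hAsm` (Conjecture A at the Heegner twists) and `hTwL` (crux 19357's conclusion at the Heegner twists). The
O8-row twin of Part 18b's `cellGordTwo_bsdp_rankOne_sharp_five_…_of_twistLower`. Nothing booked.
[cite: MatarNekovar2019, Thm. 0.7 and §0.11] [cite: Kato2004Asterisque, Thm. 14.5 (3) (p. 236)]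
[cite: CoatesSujatha2005, statement (A)] [cite: EdixhovenManin1991, §1] [cite: Mazur1978, Cor. 4.1] [cite: Miller2011LMS, Def. 1.1] -/
theorem cellGordTwo_bsdp_rankOne_smallImage_five_of_primeCertificates_of_twistLower
    (hPub : PublishedInputsAdditiveKoly)
    (hKatoI : Kato2004.rankZero_padicValNat_sha_add_padicValNat_tamagawa_le_of_additive_potGood_of_irreducible_of_fineSelmerDual_fg)
    (hMN : MatarNekovar2019_card_sha_primary_baseChange_of_derivedPoint_not_divisible_of_irreducible)
    (hMz : mazur_not_dvd_maninConstant_of_odd)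
    (hAU : abbesUllmo_not_dvd_maninConstant_of_not_dvd_level)
    (hC2 : cesnavicius_not_two_dvd_maninConstant_of_two_dvd_level)
    (hPCert : ∀ (W : WeierstrassCurve ℚ) [W.IsElliptic] [W.IsGloballyMinimal] (p : ℕ) [Fact p.Prime]
      [NeZero (W.conductorNorm ℤ)] (K : Type) [Field K] [NumberField K]
      (Dt : ModularParametrizationData W (W.conductorNorm ℤ)) (β : ℤ) (ι : K →+* ℂ),
      W.analyticRank = 1 → N10.CellGordTwo W p → W.HasIrreducibleModPGaloisRep p →
      ¬ (∀ n : ℕ, W.HasSurjectiveModNGaloisRep (p ^ n : ℕ)) → ¬ p ∣ W.tamagawaProduct →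
      IsImaginaryQuadratic K → Odd (NumberField.discr K) → NumberField.discr K < -4 →
      SatisfiesHeegnerHypothesis (W.conductorNorm ℤ) K →
      (W.quadraticTwist (NumberField.discr K : ℚ)).entireLFunction 1 ≠ 0 →
      (4 * (W.conductorNorm ℤ : ℤ)) ∣ β ^ 2 - NumberField.discr K → ¬ (p : ℤ) ∣ Dt.c →
      ∃ (ℓ : ℕ) (d : KolyvaginHeegnerData Dt β ι ℓ), Zhang2014.IsKolyvaginPrime (W.conductorNorm ℤ) W K p ℓ ∧
        ¬ ∃ Q : (W.baseChange (ringClassField K ι ℓ)).toAffine.Point, (p : ℤ) • Q = d.derivedPoint)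
    (hAsm : ∀ (W : WeierstrassCurve ℚ) [W.IsElliptic] [W.IsGloballyMinimal] (p : ℕ) [Fact p.Prime]
      (K : Type) [Field K] [NumberField K]
      (Wd : WeierstrassCurve ℚ) [Wd.IsElliptic] [Wd.IsGloballyMinimal] (Cd : VariableChange ℚ),
      W.analyticRank = 1 → N10.CellGordTwo W p → W.HasIrreducibleModPGaloisRep p →
      ¬ (∀ n : ℕ, W.HasSurjectiveModNGaloisRep (p ^ n : ℕ)) →
      IsImaginaryQuadratic K → SatisfiesHeegnerHypothesis (W.conductorNorm ℤ) K →
      (W.quadraticTwist (NumberField.discr K : ℚ)).entireLFunction 1 ≠ 0 →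
      Cd • W.quadraticTwist (NumberField.discr K : ℚ) = Wd →
      ∀ κ : ZpExtension ℚ p, κ.IsCyclotomic →
        ∃ (γ : Field.absoluteGaloisGroup ℚ) (D : Wd.FineSelmerDualData κ γ),
          Module.Finite ℤ_[p] (RestrictScalars ℤ_[p] (IwasawaAlgebra p) D.X))
    (hTwL : ∀ (W : WeierstrassCurve ℚ) [W.IsElliptic] [W.IsGloballyMinimal] (p : ℕ) [Fact p.Prime]
      (K : Type) [Field K] [NumberField K]
      (Wd : WeierstrassCurve ℚ) [Wd.IsElliptic] [Wd.IsGloballyMinimal] (Cd : VariableChange ℚ),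
      W.analyticRank = 1 → N10.CellGordTwo W p → W.HasIrreducibleModPGaloisRep p →
      ¬ (∀ n : ℕ, W.HasSurjectiveModNGaloisRep (p ^ n : ℕ)) →
      IsImaginaryQuadratic K → SatisfiesHeegnerHypothesis (W.conductorNorm ℤ) K →
      (W.quadraticTwist (NumberField.discr K : ℚ)).entireLFunction 1 ≠ 0 →
      Cd • W.quadraticTwist (NumberField.discr K : ℚ) = Wd → Typed.MissingLowerBoundAt Wd p) :
    ∀ (W : WeierstrassCurve ℚ) [W.IsElliptic] [W.IsGloballyMinimal] (p : ℕ) [Fact p.Prime],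
      W.analyticRank = 1 → N10.CellGordTwo W p → 5 ≤ p → ¬ W.HasCM → W.HasIrreducibleModPGaloisRep p →
      ¬ (∀ n : ℕ, W.HasSurjectiveModNGaloisRep (p ^ n : ℕ)) → ¬ p ∣ W.tamagawaProduct → BSDp W p := by
  intro W _ _ p _ hr hc2 hp5 hCM hirr hns htam0
  haveI : NeZero (W.conductorNorm ℤ) := ⟨(W.conductorNorm_pos_holds).ne'⟩
  obtain ⟨hp2, hadd, hG⟩ : p ≠ 2 ∧ Addv W p ∧ TypeGOrd W p := ⟨hc2.1, hc2.2.1, hc2.2.2.1⟩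
  have hj : 0 ≤ padicValRat p W.j := not_lt.mp (N10.not_potMult_of_typeGOrd W p hp2 hadd hG)
  have hD : ∃ Dt : ModularParametrizationData W (W.conductorNorm ℤ), ¬ (p : ℤ) ∣ Dt.c :=
    exists_modularParametrizationData_not_dvd_of_cellGordTwo_of_irr hPub.2.2.2.2.2.1 hMz hAU hC2 W p hc2 hirr
  exact bsdp_rankOne_additive_irr_five_of_primeCertificate_of_conjA_of_twistLower hPub hKatoI hMN W p hCM hp5 hadd hj hr
    hirr htam0 hD
    (fun K _ _ Dt β ι hK hodd hlt hHN hLt hβ hc ↦ hPCert W p K Dt β ι hr hc2 hirr hns htam0 hK hodd hlt hHN hLt hβ hc)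
    (fun K _ _ Wd _ _ Cd hK hHN hLt hWd ↦ hAsm W p K Wd Cd hr hc2 hirr hns hK hHN hLt hWd)
    (fun K _ _ Wd _ _ Cd hK hHN hLt hWd ↦ hTwL W p K Wd Cd hr hc2 hirr hns hK hHN hLt hWd)

end Summit.BirchSwinnertonDyer.BirchSwinnertonDyer.Theorems.AdditiveBranchIMCGordTwoRankOne.HeegnerKolyvagin

end
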